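import Summits.QuantumFields.YangMills.Theses.F4SubCurvatureDoor
import Summits.QuantumFields.YangMills.Theorems.F4SubCurvatureDoorSubCurvatureKernelSoftAssembly
import Summits.QuantumFields.YangMills.Theorems.F4SubCurvatureDoorSubCurvatureKernelPointwiseRP
import HarnessLib

/-!
# Route `F4SubCurvatureDoor` — GLUE of the split of `SubCurvatureKernel` ⟨stmt-QuantumFields-23036⟩ (gen 1, 2026-08-29):
# `SubCurvatureKernelOfContinuousKernel` ⟨stmt-QuantumFields-23764⟩ = `ContinuousKernel → SubCurvatureClause → SubCurvatureKernel`, BY NAME.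

Proof (15 lines, over landed theorems): obtain the continuous representing kernel `K` from `ContinuousKernel` ⟨23762⟩;
✓`soft_clauses_of_continuous_kernel` (p736949) gives clauses 1, 2, 3, 6, 7 of the parent, ✓`pointwise_rp_of_offDiagLimitAlong`
(p737157) clause 4, and `SubCurvatureClause` ⟨23763⟩ supplies `‖x‖⁸ K → 0`.
Prepared by planner ym-idea-3 g23 (split filed 21:25Z on director-ym g16 «SPLIT GO»); to be filed by a prover with
`ledger propose --kind proof --target Summits/QuantumFields/YangMills/Theorems/F4SubCurvatureDoorSubCurvatureKernelOfContinuousKernel.lean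
 --file <this> --workitem stmt-QuantumFields-23764`.
HONEST LABEL: closes only the GLUE item; ⟨23762⟩ (continuity, line os_continuity) and ⟨23763⟩ (AF, the crux) are OPEN; ⟨23036⟩ stays open until
both close; the Yang–Mills mass gap is NOT proved; no summit is proved by a line.
-/

open Filter Topology MeasureTheory
open Literature.MathematicalPhysics.QuantumFieldTheory Literature.MathematicalPhysics.QuantumLattice Literature.MathematicalPhysics.AQFT
open Summit.QuantumFields.YangMills.Theorems.F4SubCurvatureDoorSubCurvatureKernelSoft (soft_clauses_of_continuous_kernel)
open Summit.QuantumFields.YangMills.Theorems.F4SubCurvatureDoorSubCurvatureKernelPointwiseRP (pointwise_rp_of_offDiagLimitAlong)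


namespace Summit.QuantumFields.YangMills.Theorems.F4SubCurvatureDoorSubCurvatureKernelOfContinuousKernel

open Summit.QuantumFields.YangMills.Theses.F4SubCurvatureDoor

/-- ⟨stmt-QuantumFields-23764⟩ by name: the glue of the split `ContinuousKernel ∧ SubCurvatureClause ⟹ SubCurvatureKernel`. -/
theorem subCurvatureKernelOfContinuousKernel_proof :
    Summit.QuantumFields.YangMills.Theses.F4SubCurvatureDoor.SubCurvatureKernelOfContinuousKernel := by
  intro hcont hclause G _ _ _ _ hG
  letI : MeasurableSpace G := borel G
  haveI : BorelSpace G := ⟨rfl⟩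
  intro r a hapos ha0 hMB sch hsch φ hφ S₁ hS₁
  obtain ⟨K, hKm, hKc, ⟨A, hKb⟩, hrep⟩ := hcont G hG r a hapos ha0 hMB sch hsch φ hφ S₁ hS₁
  have hrepc : ∀ F : SchwartzMap (Fin 2 → EuclideanSpace ℝ (Fin 4)) ℂ, IsOffDiagonal F →
      HasCompactSupport (F : (Fin 2 → EuclideanSpace ℝ (Fin 4)) → ℂ) →
      MeasureTheory.Integrable (fun x : Fin 2 → EuclideanSpace ℝ (Fin 4) => (K (x 0 - x 1) : ℂ) * F x) ∧
        S₁ 2 F = ∫ x : Fin 2 → EuclideanSpace ℝ (Fin 4), (K (x 0 - x 1) : ℂ) * F x :=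
    fun F hF _ => hrep F hF
  obtain ⟨h1, h2, h3, h6, h7⟩ :=
    soft_clauses_of_continuous_kernel r hapos ha0 hMB hsch hφ hS₁ K hKm hKc hKb hrep
  have h4 := pointwise_rp_of_offDiagLimitAlong r hapos ha0 hMB hsch hφ hS₁ K hKc hrepc
  exact ⟨K, h1, h2, h3, h4, hclause G hG r a hapos ha0 hMB sch hsch φ hφ S₁ hS₁ K hKc hrepc, h6, h7⟩


end Summit.QuantumFields.YangMills.Theorems.F4SubCurvatureDoorSubCurvatureKernelOfContinuousKernel
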